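import Summits.QuantumFields.YangMills.Theorems.LuscherReductionTwistedTraceScalingBOStiffTensorPoincare
import HarnessLib

/-!
# (B-ST) slow ⊗ fibre assembly: from the bilinear FIBRE bound and the one-site OPERATOR bound to the stiff bound for a kernel two-sided near a product `k(u,u')·M(x,x')`
# (lane A of S-BASE, crux `TwistedTraceScaling` stmt-QuantumFields-20203, C4-CORE, the (B-ST) pen; design card `pub/ym-fleet/ym-luscher-20007-p1/Lines-BST-poincare.md` (C)+(D)+(E))

Abstract setting: finite measure spaces `(U, ν)` (slow) and `(X, μ)` (fibre); a bounded measurable kernel `G` on `U × X` which on the support of the test function is two-sided near the product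
`k(u,u')·M(x,x')` — `|G − kM| ≤ η_t·kM + τ` (`k ≥ 0`; the exact transport `…BOTransport` + envelopes supply `η_t → 0` and a superpolynomially small `τ`); the FIBRE bound of
`…BOStiffFibreBilinear.kform_bilinear_bound` for `M` (weight `w ≥ 0`, profile `Θ`, `Z > 0`; constants `Λ, 1−θ₁, A₁, A₂ ≥ 0`), and the SLOW operator bound `∫∫ a k b ≤ κ₀‖a‖₂‖b‖₂` for
non-negative bounded measurable `a, b` (`…BOStiffSlowTop`: `κ₀ = λ₀(L³β)/K₁(1,1)`, Perron–Frobenius — no row sums).  For every bounded measurable `v` on `U × X` with `v(u,·)` supported in `S`: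
★★★ `form_le_of_product_near` —
`∫∫ vGv ≤ κ₀Λ·[(1+η_t)(1−θ₁)·N + A₁·C + 2A₂·√N·√C + η_t(1−θ₁+A₁+2A₂)·N] + τ·(∫|v|)²`,  `N = ∫∫ v²w`, `C = ∫_u (∫_x v(u,x)Θ(x)w(x))²/Z du` (the fibrewise ground coefficients — `0` for
states fibrewise `w`-orthogonal to `Θ`, the hypothesis of `hST`).  With `θ₁` from the door this is `hST` up to the instances (transport, quasimode/defect, jump floor, PiDensity, currency, tails).
* §1 fibre functionals `n(u) = √(∫v(u,·)²w)`, `c(u) = |∫v(u,·)Θw|/√Z`: measurable, bounded, `c ≤ n`; §2 the product form as `∫∫ k(u,u')·B_M(v_u,v_{u'})` (Fubini); §3 ★★★ the assembly.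
HONEST FRAMING: measure-theoretic bookkeeping for a stub of a child of the CONDITIONAL route R2b1; (B-ST) OPEN; C4-CORE OPEN; not infinite volume, not a gap, not Clay.
-/

set_option autoImplicit false

noncomputable section

open MeasureTheory

namespace Summit.QuantumFields.YangMills.Theorems.FemtoTransferGap.StiffDoor

variable {U X : Type*} [MeasurableSpace U] [MeasurableSpace X] {ν : Measure U} {μ : Measure X} [IsFiniteMeasure ν] [IsFiniteMeasure μ]

/-! ## §1 Fibre functionals of a bounded measurable `v` on `U × X` -/

section Functionals

variable {v : U × X → ℝ} {w Θ : X → ℝ} {Cv Cw CΘ : ℝ}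

/-- `u ↦ ∫ v(u,x)²w(x) dμ` and `u ↦ ∫ v(u,x)Θ(x)w(x) dμ` are measurable and bounded. [folklore] -/
theorem fibre_functionals_props (hv : Measurable v) (hvb : ∀ p, |v p| ≤ Cv) (hw : Measurable w) (hwb : ∀ x, |w x| ≤ Cw) (hΘ : Measurable Θ) (hΘb : ∀ x, |Θ x| ≤ CΘ) :
    (Measurable fun u => ∫ x, v (u, x) ^ 2 * w x ∂μ) ∧ (∀ u, |∫ x, v (u, x) ^ 2 * w x ∂μ| ≤ Cv ^ 2 * Cw * μ.real Set.univ) ∧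
      (Measurable fun u => ∫ x, v (u, x) * Θ x * w x ∂μ) ∧ (∀ u, |∫ x, v (u, x) * Θ x * w x ∂μ| ≤ Cv * CΘ * Cw * μ.real Set.univ) := by
  obtain ⟨m1, b1⟩ := measurable_integral_fibre (κ := μ) (F := fun p : U × X => v p ^ 2 * w p.2) ((hv.pow_const 2).mul (hw.comp measurable_snd)) (C := Cv ^ 2 * Cw) fun p => by
    rw [abs_mul, abs_pow]; exact mul_le_mul (pow_le_pow_left₀ (abs_nonneg _) (hvb p) 2) (hwb p.2) (abs_nonneg _) (sq_nonneg _)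
  obtain ⟨m2, b2⟩ := measurable_integral_fibre (κ := μ) (F := fun p : U × X => v p * Θ p.2 * w p.2) ((hv.mul (hΘ.comp measurable_snd)).mul (hw.comp measurable_snd))
    (C := Cv * CΘ * Cw) fun p => by
      rw [abs_mul, abs_mul]
      have h0 : 0 ≤ Cv := (abs_nonneg _).trans (hvb p)
      exact mul_le_mul (mul_le_mul (hvb p) (hΘb p.2) (abs_nonneg _) h0) (hwb p.2) (abs_nonneg _) (mul_nonneg h0 ((abs_nonneg _).trans (hΘb p.2)))
  exact ⟨m1, b1, m2, b2⟩

/-- Weighted Cauchy–Schwarz for the ground coefficient: `(∫ fΘw)² ≤ (∫ f²w)(∫ Θ²w)` for `w ≥ 0`. [folklore] -/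
theorem sq_integral_mul_weight_le {f : X → ℝ} {Cf : ℝ} (hf : Measurable f) (hfb : ∀ x, |f x| ≤ Cf) (hΘ : Measurable Θ) (hΘb : ∀ x, |Θ x| ≤ CΘ) (hw : Measurable w)
    (hwb : ∀ x, |w x| ≤ Cw) (hw0 : ∀ x, 0 ≤ w x) :
    (∫ x, f x * Θ x * w x ∂μ) ^ 2 ≤ (∫ x, f x ^ 2 * w x ∂μ) * ∫ x, Θ x ^ 2 * w x ∂μ := by
  have hCf0 : ∀ x, 0 ≤ Cf := fun x => (abs_nonneg _).trans (hfb x)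
  have iA : Integrable (fun x => f x ^ 2 * w x) μ := integrable_of_measurable_abs_le μ ((hf.pow_const 2).mul hw) (C := Cf ^ 2 * Cw) fun x => by
    rw [abs_mul, abs_pow]; exact mul_le_mul (pow_le_pow_left₀ (abs_nonneg _) (hfb x) 2) (hwb x) (abs_nonneg _) (sq_nonneg _)
  have iB : Integrable (fun x => f x * Θ x * w x) μ := integrable_of_measurable_abs_le μ ((hf.mul hΘ).mul hw) (C := Cf * CΘ * Cw) fun x => by
    rw [abs_mul, abs_mul]; exact mul_le_mul (mul_le_mul (hfb x) (hΘb x) (abs_nonneg _) (hCf0 x)) (hwb x) (abs_nonneg _) (mul_nonneg (hCf0 x) ((abs_nonneg _).trans (hΘb x)))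
  have iC : Integrable (fun x => Θ x ^ 2 * w x) μ := integrable_of_measurable_abs_le μ ((hΘ.pow_const 2).mul hw) (C := CΘ ^ 2 * Cw) fun x => by
    rw [abs_mul, abs_pow]; exact mul_le_mul (pow_le_pow_left₀ (abs_nonneg _) (hΘb x) 2) (hwb x) (abs_nonneg _) (sq_nonneg _)
  set A := ∫ x, f x ^ 2 * w x ∂μ
  set B := ∫ x, f x * Θ x * w x ∂μ
  set C := ∫ x, Θ x ^ 2 * w x ∂μ
  have hquad : ∀ t : ℝ, 0 ≤ C * (t * t) + 2 * B * t + A := by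
    intro t
    have h0 : 0 ≤ ∫ x, (f x + t * Θ x) ^ 2 * w x ∂μ := integral_nonneg fun x => mul_nonneg (sq_nonneg _) (hw0 x)
    have e : (fun x => (f x + t * Θ x) ^ 2 * w x) = fun x => (f x ^ 2 * w x + (2 * t) * (f x * Θ x * w x)) + t ^ 2 * (Θ x ^ 2 * w x) := funext fun x => by ring
    have i1 : Integrable (fun x => f x ^ 2 * w x + (2 * t) * (f x * Θ x * w x)) μ := iA.add (iB.const_mul _)
    rw [e, integral_add i1 (iC.const_mul _), integral_add iA (iB.const_mul _), integral_const_mul, integral_const_mul] at h0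
    nlinarith [h0]
  have hd := discrim_le_zero hquad
  rw [discrim] at hd
  nlinarith [hd]

end Functionals

/-! ## §2 The product form as a slow double integral of fibre forms -/

section Product

variable {v : U × X → ℝ} {k : U → U → ℝ} {M : X → X → ℝ} {Cv Ck CM : ℝ}

/-- The fibre form `(u,u') ↦ ∫∫ v(u,x)M(x,x')v(u',x')` is measurable on `U × U` and bounded. [folklore] -/
theorem measurable_fibreForm (hv : Measurable v) (hvb : ∀ p, |v p| ≤ Cv) (hM : Measurable (Function.uncurry M)) (hMb : ∀ x y, |M x y| ≤ CM) :
    (Measurable fun uu : U × U => ∫ x, ∫ x', v (uu.1, x) * M x x' * v (uu.2, x') ∂μ ∂μ) ∧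
      ∀ uu : U × U, |∫ x, ∫ x', v (uu.1, x) * M x x' * v (uu.2, x') ∂μ ∂μ| ≤ Cv * CM * Cv * μ.real Set.univ * μ.real Set.univ := by
  obtain ⟨m1, b1⟩ := measurable_integral_fibre (κ := μ) (F := fun r : ((U × U) × X) × X => v (r.1.1.1, r.1.2) * M r.1.2 r.2 * v (r.1.1.2, r.2))
    (((hv.comp (((measurable_fst.comp measurable_fst).comp measurable_fst).prodMk (measurable_snd.comp measurable_fst))).mul
      (hM.comp ((measurable_snd.comp measurable_fst).prodMk measurable_snd))).mul (hv.comp (((measurable_snd.comp measurable_fst).comp measurable_fst).prodMk measurable_snd)))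
    (C := Cv * CM * Cv) fun r => by
      have h0 : 0 ≤ Cv := (abs_nonneg _).trans (hvb (r.1.1.1, r.1.2))
      rw [abs_mul, abs_mul]
      exact mul_le_mul (mul_le_mul (hvb _) (hMb _ _) (abs_nonneg _) h0) (hvb _) (abs_nonneg _) (mul_nonneg h0 ((abs_nonneg _).trans (hMb r.1.2 r.2)))
  obtain ⟨m2, b2⟩ := measurable_integral_fibre (κ := μ) (F := fun r : (U × U) × X => ∫ x', v (r.1.1, r.2) * M r.2 x' * v (r.1.2, x') ∂μ) m1 (C := Cv * CM * Cv * μ.real Set.univ)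
    fun r => b1 r
  exact ⟨m2, b2⟩

end Product


/-! ## §3 ★★★ The assembly -/

section Assembly

variable {v : U × X → ℝ} {G : U × X → U × X → ℝ} {k : U → U → ℝ} {M : X → X → ℝ} {w Θ : X → ℝ} {S : Set X}
  {Cv CG Ck CM Cw CΘ Λ θ₁ A₁ A₂ κ₀ ηt τ : ℝ}

/-- Reshuffle: `∫_p∫_q v(p)·k(p₁,q₁)M(p₂,q₂)·v'(q) = ∫_u∫_{u'} k(u,u')·(∫_x∫_{x'} v(u,x)M(x,x')v'(u',x'))` for bounded measurable data. [folklore] -/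
theorem integral_product_kernel_eq {v v' : U × X → ℝ} {Cv' : ℝ} (hv : Measurable v) (hvb : ∀ p, |v p| ≤ Cv) (hv' : Measurable v') (hv'b : ∀ p, |v' p| ≤ Cv')
    (hk : Measurable (Function.uncurry k)) (hkb : ∀ u u', |k u u'| ≤ Ck) (hM : Measurable (Function.uncurry M)) (hMb : ∀ x y, |M x y| ≤ CM) :
    ∫ p, ∫ q, v p * (k p.1 q.1 * M p.2 q.2) * v' q ∂(ν.prod μ) ∂(ν.prod μ) =
      ∫ u, ∫ u', k u u' * (∫ x, ∫ x', v (u, x) * M x x' * v' (u', x') ∂μ ∂μ) ∂ν ∂ν := by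
  -- the 4-variable integrand
  set F : (U × X) × (U × X) → ℝ := fun pq => v pq.1 * (k pq.1.1 pq.2.1 * M pq.1.2 pq.2.2) * v' pq.2 with hF
  have hFm : Measurable F := ((hv.comp measurable_fst).mul ((hk.comp ((measurable_fst.comp measurable_fst).prodMk (measurable_fst.comp measurable_snd))).mul
    (hM.comp ((measurable_snd.comp measurable_fst).prodMk (measurable_snd.comp measurable_snd))))).mul (hv'.comp measurable_snd)
  have hFb : ∀ pq, |F pq| ≤ Cv * (Ck * CM) * Cv' := fun pq => by
    have h0 : 0 ≤ Cv := (abs_nonneg _).trans (hvb pq.1)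
    have h1 : 0 ≤ Ck := (abs_nonneg _).trans (hkb pq.1.1 pq.2.1)
    simp only [hF]; rw [abs_mul, abs_mul, abs_mul]
    exact mul_le_mul (mul_le_mul (hvb _) (mul_le_mul (hkb _ _) (hMb _ _) (abs_nonneg _) h1) (mul_nonneg (abs_nonneg _) (abs_nonneg _)) h0) (hv'b _) (abs_nonneg _)
      (mul_nonneg h0 (mul_nonneg h1 ((abs_nonneg _).trans (hMb pq.1.2 pq.2.2))))
  -- `∫_p ∫_q F = ∫_u ∫_x ∫_{u'} ∫_{x'} F`
  have i2 : Integrable F ((ν.prod μ).prod (ν.prod μ)) := integrable_of_measurable_abs_le _ hFm hFb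
  have e1 : ∫ p, ∫ q, v p * (k p.1 q.1 * M p.2 q.2) * v' q ∂(ν.prod μ) ∂(ν.prod μ) = ∫ u, ∫ x, ∫ q, F ((u, x), q) ∂(ν.prod μ) ∂μ ∂ν := by
    rw [← integral_prod _ i2.integral_prod_left]
  rw [e1]
  refine integral_congr_ae (ae_of_all _ fun u => ?_)
  dsimp only
  -- for fixed `u`: `∫_x ∫_q F = ∫_x ∫_{u'} ∫_{x'} F`, swap `x ↔ u'`, pull `k` out
  have iq : ∀ x, Integrable (fun q : U × X => F ((u, x), q)) (ν.prod μ) := fun x =>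
    integrable_of_measurable_abs_le _ (hFm.comp (measurable_const.prodMk measurable_id)) fun q => hFb _
  have e2 : (fun x => ∫ q, F ((u, x), q) ∂(ν.prod μ)) = fun x => ∫ u', ∫ x', F ((u, x), (u', x')) ∂μ ∂ν := funext fun x => integral_prod _ (iq x)
  rw [e2]
  have hsw : Integrable (Function.uncurry fun x u' => ∫ x', F ((u, x), (u', x')) ∂μ) (μ.prod ν) := by
    have hm : Measurable fun r : (X × U) × X => F ((u, r.1.1), (r.1.2, r.2)) :=
      hFm.comp ((measurable_const.prodMk (measurable_fst.comp measurable_fst)).prodMk ((measurable_snd.comp measurable_fst).prodMk measurable_snd))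
    refine integrable_of_measurable_abs_le _ (hm.stronglyMeasurable.integral_prod_right' (ν := μ)).measurable (C := Cv * (Ck * CM) * Cv' * μ.real Set.univ) fun r => ?_
    have h := norm_integral_le_of_norm_le_const (μ := μ) (f := fun x' => F ((u, r.1), (r.2, x'))) (C := Cv * (Ck * CM) * Cv')
      (Filter.Eventually.of_forall fun x' => by rw [Real.norm_eq_abs]; exact hFb _)
    rw [Real.norm_eq_abs] at h
    simpa [Function.uncurry, mul_comm] using h
  rw [integral_integral_swap hsw]
  refine integral_congr_ae (ae_of_all _ fun u' => ?_)
  dsimp only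
  rw [← integral_const_mul]
  refine integral_congr_ae (ae_of_all _ fun x => ?_)
  dsimp only
  rw [← integral_const_mul]
  refine integral_congr_ae (ae_of_all _ fun x' => ?_)
  simp only [hF]; ring

/-- ★★★ **THE SLOW ⊗ FIBRE ASSEMBLY.**  See the module docstring.  [cite: Luscher1983, §3] [cite: Helffer2013, §7] -/
theorem form_le_of_product_near (hv : Measurable v) (hvb : ∀ p, |v p| ≤ Cv) (hvS : ∀ u x, x ∉ S → v (u, x) = 0)
    (hG : Measurable (Function.uncurry G)) (hGb : ∀ p q, |G p q| ≤ CG) (hk : Measurable (Function.uncurry k)) (hkb : ∀ u u', |k u u'| ≤ Ck) (hk0 : ∀ u u', 0 ≤ k u u')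
    (hM : Measurable (Function.uncurry M)) (hMb : ∀ x y, |M x y| ≤ CM) (hw : Measurable w) (hwb : ∀ x, |w x| ≤ Cw) (hw0 : ∀ x, 0 ≤ w x)
    (hΘ : Measurable Θ) (hΘb : ∀ x, |Θ x| ≤ CΘ) (hZ : 0 < ∫ x, Θ x ^ 2 * w x ∂μ) (hΛ : 0 ≤ Λ) (hθ : 0 ≤ 1 - θ₁) (hA₁ : 0 ≤ A₁) (hA₂ : 0 ≤ A₂) (hηt : 0 ≤ ηt)
    (hnear : ∀ p q, |G p q - k p.1 q.1 * M p.2 q.2| ≤ ηt * (k p.1 q.1 * M p.2 q.2) + τ)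
    (hfib : ∀ f f' : X → ℝ, Measurable f → (∃ C : ℝ, ∀ x, |f x| ≤ C) → (∀ x, x ∉ S → f x = 0) → Measurable f' → (∃ C : ℝ, ∀ x, |f' x| ≤ C) → (∀ x, x ∉ S → f' x = 0) →
      ∫ x, ∫ y, f x * M x y * f' y ∂μ ∂μ ≤
        Λ * ((1 - θ₁) * (Real.sqrt (∫ x, f x ^ 2 * w x ∂μ) * Real.sqrt (∫ x, f' x ^ 2 * w x ∂μ)) +
          A₁ * (|∫ x, f x * Θ x * w x ∂μ| / Real.sqrt (∫ x, Θ x ^ 2 * w x ∂μ) * (|∫ x, f' x * Θ x * w x ∂μ| / Real.sqrt (∫ x, Θ x ^ 2 * w x ∂μ))) +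
          A₂ * (|∫ x, f x * Θ x * w x ∂μ| / Real.sqrt (∫ x, Θ x ^ 2 * w x ∂μ) * Real.sqrt (∫ x, f' x ^ 2 * w x ∂μ) +
            |∫ x, f' x * Θ x * w x ∂μ| / Real.sqrt (∫ x, Θ x ^ 2 * w x ∂μ) * Real.sqrt (∫ x, f x ^ 2 * w x ∂μ))))
    (hkop : ∀ a b : U → ℝ, Measurable a → Measurable b → (∃ C : ℝ, ∀ u, |a u| ≤ C) → (∃ C : ℝ, ∀ u, |b u| ≤ C) → (∀ u, 0 ≤ a u) → (∀ u, 0 ≤ b u) →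
      ∫ u, ∫ u', a u * k u u' * b u' ∂ν ∂ν ≤ κ₀ * (Real.sqrt (∫ u, a u ^ 2 ∂ν) * Real.sqrt (∫ u, b u ^ 2 ∂ν))) :
    ∫ p, ∫ q, v p * G p q * v q ∂(ν.prod μ) ∂(ν.prod μ) ≤
      κ₀ * Λ * ((1 - θ₁) * (∫ u, ∫ x, v (u, x) ^ 2 * w x ∂μ ∂ν) + A₁ * (∫ u, (∫ x, v (u, x) * Θ x * w x ∂μ) ^ 2 / (∫ x, Θ x ^ 2 * w x ∂μ) ∂ν) +
          2 * A₂ * (Real.sqrt (∫ u, ∫ x, v (u, x) ^ 2 * w x ∂μ ∂ν) * Real.sqrt (∫ u, (∫ x, v (u, x) * Θ x * w x ∂μ) ^ 2 / (∫ x, Θ x ^ 2 * w x ∂μ) ∂ν)) +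
          ηt * ((1 - θ₁) + A₁ + 2 * A₂) * (∫ u, ∫ x, v (u, x) ^ 2 * w x ∂μ ∂ν)) +
        τ * (∫ p, |v p| ∂(ν.prod μ)) ^ 2 := by
  -- fibre functionals
  obtain ⟨hnm, hnb, hcm, hcb⟩ := fibre_functionals_props (μ := μ) hv hvb hw hwb hΘ hΘb
  set Z := ∫ x, Θ x ^ 2 * w x ∂μ with hZdef
  set nsq : U → ℝ := fun u => ∫ x, v (u, x) ^ 2 * w x ∂μ with hnsq
  set m : U → ℝ := fun u => ∫ x, v (u, x) * Θ x * w x ∂μ with hmdef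
  set n : U → ℝ := fun u => Real.sqrt (nsq u) with hndef
  set c : U → ℝ := fun u => |m u| / Real.sqrt Z with hcdef
  have hsZ : 0 < Real.sqrt Z := Real.sqrt_pos.2 hZ
  have hnsq0 : ∀ u, 0 ≤ nsq u := fun u => integral_nonneg fun x => mul_nonneg (sq_nonneg _) (hw0 x)
  have hn0 : ∀ u, 0 ≤ n u := fun u => Real.sqrt_nonneg _
  have hc0 : ∀ u, 0 ≤ c u := fun u => div_nonneg (abs_nonneg _) hsZ.le
  have hnmeas : Measurable n := hnm.sqrt
  have hcmeas : Measurable c := hcm.abs.div_const _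
  have hnbd : ∀ u, |n u| ≤ Real.sqrt (Cv ^ 2 * Cw * μ.real Set.univ) := fun u => by
    rw [abs_of_nonneg (hn0 u)]; exact Real.sqrt_le_sqrt ((le_abs_self _).trans (hnb u))
  have hcbd : ∀ u, |c u| ≤ Cv * CΘ * Cw * μ.real Set.univ / Real.sqrt Z := fun u => by
    rw [abs_of_nonneg (hc0 u)]; exact div_le_div_of_nonneg_right (hcb u) hsZ.le
  have hn2 : ∀ u, n u ^ 2 = nsq u := fun u => Real.sq_sqrt (hnsq0 u)
  have hc2 : ∀ u, c u ^ 2 = m u ^ 2 / Z := fun u => by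
    simp only [hcdef]; rw [div_pow, sq_abs, Real.sq_sqrt hZ.le]
  -- sections of `v`
  have hvu : ∀ u, Measurable fun x => v (u, x) := fun u => hv.comp (measurable_const.prodMk measurable_id)
  have hvub : ∀ u x, |v (u, x)| ≤ Cv := fun u x => hvb (u, x)
  -- `c ≤ n` (weighted Cauchy–Schwarz), also for `|v|`
  have habs_le : ∀ {f : X → ℝ} {Cf : ℝ}, Measurable f → (∀ x, |f x| ≤ Cf) →
      |∫ x, f x * Θ x * w x ∂μ| ≤ Real.sqrt (∫ x, f x ^ 2 * w x ∂μ) * Real.sqrt Z := fun {f Cf} hf hfb => by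
    have h := sq_integral_mul_weight_le (μ := μ) hf hfb hΘ hΘb hw hwb hw0
    rw [← Real.sqrt_sq_eq_abs]
    calc Real.sqrt ((∫ x, f x * Θ x * w x ∂μ) ^ 2) ≤ Real.sqrt ((∫ x, f x ^ 2 * w x ∂μ) * Z) := Real.sqrt_le_sqrt h
      _ = Real.sqrt (∫ x, f x ^ 2 * w x ∂μ) * Real.sqrt Z := Real.sqrt_mul (integral_nonneg fun x => mul_nonneg (sq_nonneg _) (hw0 x)) Z
  have hcn : ∀ u, c u ≤ n u := fun u => by
    simp only [hcdef]; rw [div_le_iff₀ hsZ]; exact habs_le (hvu u) (hvub u)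
  -- the fibre forms `F(u,u')`, `Fabs(u,u')` and their bounds
  have hva : Measurable fun p : U × X => |v p| := hv.abs
  have hvab : ∀ p : U × X, |(|v p|)| ≤ Cv := fun p => by rw [abs_abs]; exact hvb p
  have hvau : ∀ u, Measurable fun x => |v (u, x)| := fun u => (hvu u).abs
  have hvaub : ∀ u x, |(|v (u, x)|)| ≤ Cv := fun u x => by rw [abs_abs]; exact hvb (u, x)
  have hvuS : ∀ u x, x ∉ S → (fun x => v (u, x)) x = 0 := fun u x hx => hvS u x hx
  have hvauS : ∀ u x, x ∉ S → (fun x => |v (u, x)|) x = 0 := fun u x hx => by simp only [hvS u x hx, abs_zero]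
  have hF : ∀ u u', ∫ x, ∫ x', v (u, x) * M x x' * v (u', x') ∂μ ∂μ ≤ Λ * ((1 - θ₁) * (n u * n u') + A₁ * (c u * c u') + A₂ * (c u * n u' + c u' * n u)) :=
    fun u u' => hfib (fun x => v (u, x)) (fun x => v (u', x)) (hvu u) ⟨Cv, hvub u⟩ (hvuS u) (hvu u') ⟨Cv, hvub u'⟩ (hvuS u')
  have hFabs : ∀ u u', ∫ x, ∫ x', |v (u, x)| * M x x' * |v (u', x')| ∂μ ∂μ ≤ Λ * ((1 - θ₁) + A₁ + 2 * A₂) * (n u * n u') := fun u u' => by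
    have h := hfib (fun x => |v (u, x)|) (fun x => |v (u', x)|) (hvau u) ⟨Cv, hvaub u⟩ (hvauS u) (hvau u') ⟨Cv, hvaub u'⟩ (hvauS u')
    have en : ∀ w' : U, Real.sqrt (∫ x, |v (w', x)| ^ 2 * w x ∂μ) = n w' := fun w' => by simp only [hndef, hnsq, sq_abs]
    rw [en u, en u'] at h
    have hcu : |∫ x, |v (u, x)| * Θ x * w x ∂μ| / Real.sqrt Z ≤ n u := by rw [div_le_iff₀ hsZ, ← en u]; exact habs_le (hvau u) (hvaub u)
    have hcu' : |∫ x, |v (u', x)| * Θ x * w x ∂μ| / Real.sqrt Z ≤ n u' := by rw [div_le_iff₀ hsZ, ← en u']; exact habs_le (hvau u') (hvaub u')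
    have hcu0 : 0 ≤ |∫ x, |v (u, x)| * Θ x * w x ∂μ| / Real.sqrt Z := div_nonneg (abs_nonneg _) hsZ.le
    have hcu'0 : 0 ≤ |∫ x, |v (u', x)| * Θ x * w x ∂μ| / Real.sqrt Z := div_nonneg (abs_nonneg _) hsZ.le
    refine h.trans ?_
    have t1 : A₁ * (|∫ x, |v (u, x)| * Θ x * w x ∂μ| / Real.sqrt Z * (|∫ x, |v (u', x)| * Θ x * w x ∂μ| / Real.sqrt Z)) ≤ A₁ * (n u * n u') :=
      mul_le_mul_of_nonneg_left (mul_le_mul hcu hcu' hcu'0 (hn0 u)) hA₁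
    have t2 : A₂ * (|∫ x, |v (u, x)| * Θ x * w x ∂μ| / Real.sqrt Z * n u' + |∫ x, |v (u', x)| * Θ x * w x ∂μ| / Real.sqrt Z * n u) ≤ A₂ * (n u * n u' + n u' * n u) :=
      mul_le_mul_of_nonneg_left (add_le_add (mul_le_mul_of_nonneg_right hcu (hn0 u')) (mul_le_mul_of_nonneg_right hcu' (hn0 u))) hA₂
    nlinarith [t1, t2, mul_nonneg (hn0 u) (hn0 u')]
  -- Step 1: the pointwise kernel comparison, integrated
  have hkM : Measurable (Function.uncurry fun p q : U × X => k p.1 q.1 * M p.2 q.2) :=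
    (hk.comp ((measurable_fst.comp measurable_fst).prodMk (measurable_fst.comp measurable_snd))).mul
      (hM.comp ((measurable_snd.comp measurable_fst).prodMk (measurable_snd.comp measurable_snd)))
  have hkMb : ∀ p q : U × X, |k p.1 q.1 * M p.2 q.2| ≤ Ck * CM := fun p q => by
    rw [abs_mul]; exact mul_le_mul (hkb _ _) (hMb _ _) (abs_nonneg _) ((abs_nonneg _).trans (hkb p.1 q.1))
  have mvGv : Measurable (Function.uncurry fun p q : U × X => v p * G p q * v q) := ((hv.comp measurable_fst).mul hG).mul (hv.comp measurable_snd)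
  have mvKv : Measurable (Function.uncurry fun p q : U × X => v p * (k p.1 q.1 * M p.2 q.2) * v q) := ((hv.comp measurable_fst).mul hkM).mul (hv.comp measurable_snd)
  have maKa : Measurable (Function.uncurry fun p q : U × X => |v p| * (k p.1 q.1 * M p.2 q.2) * |v q|) := ((hva.comp measurable_fst).mul hkM).mul (hva.comp measurable_snd)
  have maa : Measurable (Function.uncurry fun p q : U × X => |v p| * |v q|) := (hva.comp measurable_fst).mul (hva.comp measurable_snd)
  have bvGv : ∀ p q : U × X, |v p * G p q * v q| ≤ Cv * CG * Cv := fun p q => by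
    have h0 : 0 ≤ Cv := (abs_nonneg _).trans (hvb p)
    rw [abs_mul, abs_mul]; exact mul_le_mul (mul_le_mul (hvb p) (hGb p q) (abs_nonneg _) h0) (hvb q) (abs_nonneg _) (mul_nonneg h0 ((abs_nonneg _).trans (hGb p q)))
  have bvKv : ∀ p q : U × X, |v p * (k p.1 q.1 * M p.2 q.2) * v q| ≤ Cv * (Ck * CM) * Cv := fun p q => by
    have h0 : 0 ≤ Cv := (abs_nonneg _).trans (hvb p)
    rw [abs_mul, abs_mul]; exact mul_le_mul (mul_le_mul (hvb p) (hkMb p q) (abs_nonneg _) h0) (hvb q) (abs_nonneg _) (mul_nonneg h0 ((abs_nonneg _).trans (hkMb p q)))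
  have baKa : ∀ p q : U × X, |(|v p|) * (k p.1 q.1 * M p.2 q.2) * (|v q|)| ≤ Cv * (Ck * CM) * Cv := fun p q => by
    have h0 : 0 ≤ Cv := (abs_nonneg _).trans (hvb p)
    rw [abs_mul, abs_mul, abs_abs, abs_abs]; exact mul_le_mul (mul_le_mul (hvb p) (hkMb p q) (abs_nonneg _) h0) (hvb q) (abs_nonneg _) (mul_nonneg h0 ((abs_nonneg _).trans (hkMb p q)))
  have baa : ∀ p q : U × X, |(|v p|) * (|v q|)| ≤ Cv * Cv := fun p q => by
    rw [abs_mul, abs_abs, abs_abs]; exact mul_le_mul (hvb p) (hvb q) (abs_nonneg _) ((abs_nonneg _).trans (hvb p))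
  have hstep1 : ∫ p, ∫ q, v p * G p q * v q ∂(ν.prod μ) ∂(ν.prod μ) ≤
      (∫ p, ∫ q, v p * (k p.1 q.1 * M p.2 q.2) * v q ∂(ν.prod μ) ∂(ν.prod μ)) + ηt * (∫ p, ∫ q, |v p| * (k p.1 q.1 * M p.2 q.2) * |v q| ∂(ν.prod μ) ∂(ν.prod μ)) +
        τ * ∫ p, ∫ q, |v p| * |v q| ∂(ν.prod μ) ∂(ν.prod μ) := by
    have I0 : Integrable (fun pq : (U × X) × (U × X) => v pq.1 * G pq.1 pq.2 * v pq.2) ((ν.prod μ).prod (ν.prod μ)) := integrable_prod_of_bdd (μ := ν.prod μ) mvGv bvGv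
    have I1 : Integrable (fun pq : (U × X) × (U × X) => v pq.1 * (k pq.1.1 pq.2.1 * M pq.1.2 pq.2.2) * v pq.2) ((ν.prod μ).prod (ν.prod μ)) :=
      integrable_prod_of_bdd (μ := ν.prod μ) mvKv bvKv
    have I2 : Integrable (fun pq : (U × X) × (U × X) => ηt * (|v pq.1| * (k pq.1.1 pq.2.1 * M pq.1.2 pq.2.2) * |v pq.2|)) ((ν.prod μ).prod (ν.prod μ)) :=
      (integrable_prod_of_bdd (μ := ν.prod μ) maKa baKa).const_mul ηt
    have I3 : Integrable (fun pq : (U × X) × (U × X) => τ * (|v pq.1| * |v pq.2|)) ((ν.prod μ).prod (ν.prod μ)) := (integrable_prod_of_bdd (μ := ν.prod μ) maa baa).const_mul τ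
    have I12 : Integrable (fun pq : (U × X) × (U × X) => v pq.1 * (k pq.1.1 pq.2.1 * M pq.1.2 pq.2.2) * v pq.2 + ηt * (|v pq.1| * (k pq.1.1 pq.2.1 * M pq.1.2 pq.2.2) * |v pq.2|))
      ((ν.prod μ).prod (ν.prod μ)) := I1.add I2
    rw [integral_integral_eq_prod (μ := ν.prod μ) mvGv bvGv, integral_integral_eq_prod (μ := ν.prod μ) mvKv bvKv, integral_integral_eq_prod (μ := ν.prod μ) maKa baKa,
      integral_integral_eq_prod (μ := ν.prod μ) maa baa, ← integral_const_mul, ← integral_const_mul, ← integral_add I1 I2, ← integral_add I12 I3]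
    refine integral_mono I0 (I12.add I3) fun pq => ?_
    have h1 := hnear pq.1 pq.2
    have h2 : |v pq.1 * (G pq.1 pq.2 - k pq.1.1 pq.2.1 * M pq.1.2 pq.2.2) * v pq.2| ≤ |v pq.1| * (ηt * (k pq.1.1 pq.2.1 * M pq.1.2 pq.2.2) + τ) * |v pq.2| := by
      rw [abs_mul, abs_mul]; exact mul_le_mul_of_nonneg_right (mul_le_mul_of_nonneg_left h1 (abs_nonneg _)) (abs_nonneg _)
    have h3 := le_abs_self (v pq.1 * (G pq.1 pq.2 - k pq.1.1 pq.2.1 * M pq.1.2 pq.2.2) * v pq.2)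
    nlinarith [h2, h3]
  -- Step 2: reshuffle to slow double integrals of fibre forms
  rw [integral_product_kernel_eq (ν := ν) (μ := μ) hv hvb hv hvb hk hkb hM hMb, integral_product_kernel_eq (ν := ν) (μ := μ) hva hvab hva hvab hk hkb hM hMb] at hstep1
  -- Step 3: bound the fibre forms and use the slow operator bound
  obtain ⟨mF, bF⟩ := measurable_fibreForm (μ := μ) hv hvb hM hMb
  obtain ⟨mFa, bFa⟩ := measurable_fibreForm (μ := μ) hva hvab hM hMb
  have hK1 : ∫ u, ∫ u', k u u' * (∫ x, ∫ x', v (u, x) * M x x' * v (u', x') ∂μ ∂μ) ∂ν ∂ν ≤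
      Λ * ((1 - θ₁) * (∫ u, ∫ u', n u * k u u' * n u' ∂ν ∂ν) + A₁ * (∫ u, ∫ u', c u * k u u' * c u' ∂ν ∂ν) +
        A₂ * ((∫ u, ∫ u', c u * k u u' * n u' ∂ν ∂ν) + ∫ u, ∫ u', n u * k u u' * c u' ∂ν ∂ν)) := by
    have mL : Measurable (Function.uncurry fun u u' => k u u' * ∫ x, ∫ x', v (u, x) * M x x' * v (u', x') ∂μ ∂μ) := hk.mul mF
    have bL : ∀ u u', |k u u' * ∫ x, ∫ x', v (u, x) * M x x' * v (u', x') ∂μ ∂μ| ≤ Ck * (Cv * CM * Cv * μ.real Set.univ * μ.real Set.univ) := fun u u' => by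
      rw [abs_mul]; exact mul_le_mul (hkb u u') (bF (u, u')) (abs_nonneg _) ((abs_nonneg _).trans (hkb u u'))
    set R : U → U → ℝ := fun u u' => (1 - θ₁) * (n u * k u u' * n u') + A₁ * (c u * k u u' * c u') + A₂ * (c u * k u u' * n u' + n u * k u u' * c u') with hR
    have mnn : Measurable (Function.uncurry fun u u' => n u * k u u' * n u') := ((hnmeas.comp measurable_fst).mul hk).mul (hnmeas.comp measurable_snd)
    have mcc : Measurable (Function.uncurry fun u u' => c u * k u u' * c u') := ((hcmeas.comp measurable_fst).mul hk).mul (hcmeas.comp measurable_snd)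
    have mcn : Measurable (Function.uncurry fun u u' => c u * k u u' * n u') := ((hcmeas.comp measurable_fst).mul hk).mul (hnmeas.comp measurable_snd)
    have mnc : Measurable (Function.uncurry fun u u' => n u * k u u' * c u') := ((hnmeas.comp measurable_fst).mul hk).mul (hcmeas.comp measurable_snd)
    set Bn := Real.sqrt (Cv ^ 2 * Cw * μ.real Set.univ)
    set Bc := Cv * CΘ * Cw * μ.real Set.univ / Real.sqrt Z
    have hBn : 0 ≤ Bn := Real.sqrt_nonneg _
    have bnd : ∀ {a b : U → ℝ} {Ba Bb : ℝ}, (∀ u, |a u| ≤ Ba) → (∀ u, |b u| ≤ Bb) → 0 ≤ Ba → ∀ u u', |a u * k u u' * b u'| ≤ Ba * Ck * Bb :=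
      fun {a b Ba Bb} ha hb hBa u u' => by
        rw [abs_mul, abs_mul]; exact mul_le_mul (mul_le_mul (ha u) (hkb u u') (abs_nonneg _) hBa) (hb u') (abs_nonneg _) (mul_nonneg hBa ((abs_nonneg _).trans (hkb u u')))
    have hcbd' : ∀ u, |c u| ≤ |Bc| := fun u => (hcbd u).trans (le_abs_self _)
    have inn := integrable_prod_of_bdd (μ := ν) mnn (bnd hnbd hnbd hBn)
    have icc := integrable_prod_of_bdd (μ := ν) mcc (bnd hcbd' hcbd' (abs_nonneg _))
    have icn := integrable_prod_of_bdd (μ := ν) mcn (bnd hcbd' hnbd (abs_nonneg _))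
    have inc := integrable_prod_of_bdd (μ := ν) mnc (bnd hnbd hcbd' hBn)
    have iR : Integrable (Function.uncurry R) (ν.prod ν) := ((inn.const_mul _).add (icc.const_mul _)).add ((icn.add inc).const_mul _)
    rw [integral_integral_eq_prod (μ := ν) mL bL]
    have hle : ∫ p, Function.uncurry (fun u u' => k u u' * ∫ x, ∫ x', v (u, x) * M x x' * v (u', x') ∂μ ∂μ) p ∂(ν.prod ν) ≤ ∫ p, Λ * Function.uncurry R p ∂(ν.prod ν) := by
      refine integral_mono (integrable_prod_of_bdd (μ := ν) mL bL) (iR.const_mul Λ) fun p => ?_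
      simp only [Function.uncurry, hR]
      have h := mul_le_mul_of_nonneg_left (hF p.1 p.2) (hk0 p.1 p.2)
      nlinarith [h]
    refine hle.trans (le_of_eq ?_)
    rw [integral_const_mul]
    congr 1
    have In : Integrable (fun p : U × U => n p.1 * k p.1 p.2 * n p.2) (ν.prod ν) := inn
    have Ic : Integrable (fun p : U × U => c p.1 * k p.1 p.2 * c p.2) (ν.prod ν) := icc
    have Icn : Integrable (fun p : U × U => c p.1 * k p.1 p.2 * n p.2) (ν.prod ν) := icn
    have Inc : Integrable (fun p : U × U => n p.1 * k p.1 p.2 * c p.2) (ν.prod ν) := inc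
    have J1 : Integrable (fun p : U × U => (1 - θ₁) * (n p.1 * k p.1 p.2 * n p.2)) (ν.prod ν) := In.const_mul _
    have J2 : Integrable (fun p : U × U => A₁ * (c p.1 * k p.1 p.2 * c p.2)) (ν.prod ν) := Ic.const_mul _
    have J34 : Integrable (fun p : U × U => c p.1 * k p.1 p.2 * n p.2 + n p.1 * k p.1 p.2 * c p.2) (ν.prod ν) := Icn.add Inc
    have J34' : Integrable (fun p : U × U => A₂ * (c p.1 * k p.1 p.2 * n p.2 + n p.1 * k p.1 p.2 * c p.2)) (ν.prod ν) := J34.const_mul _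
    have J12 : Integrable (fun p : U × U => (1 - θ₁) * (n p.1 * k p.1 p.2 * n p.2) + A₁ * (c p.1 * k p.1 p.2 * c p.2)) (ν.prod ν) := J1.add J2
    have e : ∫ p, Function.uncurry R p ∂(ν.prod ν) =
        ∫ p : U × U, (((1 - θ₁) * (n p.1 * k p.1 p.2 * n p.2) + A₁ * (c p.1 * k p.1 p.2 * c p.2)) + A₂ * (c p.1 * k p.1 p.2 * n p.2 + n p.1 * k p.1 p.2 * c p.2)) ∂(ν.prod ν) := rfl
    rw [e, integral_add J12 J34', integral_add J1 J2, integral_const_mul, integral_const_mul, integral_const_mul, integral_add Icn Inc,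
      ← integral_integral_eq_prod (μ := ν) mnn (bnd hnbd hnbd hBn), ← integral_integral_eq_prod (μ := ν) mcc (bnd hcbd' hcbd' (abs_nonneg _)),
      ← integral_integral_eq_prod (μ := ν) mcn (bnd hcbd' hnbd (abs_nonneg _)), ← integral_integral_eq_prod (μ := ν) mnc (bnd hnbd hcbd' hBn)]
  have hK2 : ∫ u, ∫ u', k u u' * (∫ x, ∫ x', |v (u, x)| * M x x' * |v (u', x')| ∂μ ∂μ) ∂ν ∂ν ≤ Λ * ((1 - θ₁) + A₁ + 2 * A₂) * (∫ u, ∫ u', n u * k u u' * n u' ∂ν ∂ν) := by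
    have mL : Measurable (Function.uncurry fun u u' => k u u' * ∫ x, ∫ x', |v (u, x)| * M x x' * |v (u', x')| ∂μ ∂μ) := hk.mul mFa
    have bL : ∀ u u', |k u u' * ∫ x, ∫ x', |v (u, x)| * M x x' * |v (u', x')| ∂μ ∂μ| ≤ Ck * (Cv * CM * Cv * μ.real Set.univ * μ.real Set.univ) := fun u u' => by
      rw [abs_mul]; exact mul_le_mul (hkb u u') (bFa (u, u')) (abs_nonneg _) ((abs_nonneg _).trans (hkb u u'))
    have mnn : Measurable (Function.uncurry fun u u' => n u * k u u' * n u') := ((hnmeas.comp measurable_fst).mul hk).mul (hnmeas.comp measurable_snd)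
    have bnn : ∀ u u', |n u * k u u' * n u'| ≤ Real.sqrt (Cv ^ 2 * Cw * μ.real Set.univ) * Ck * Real.sqrt (Cv ^ 2 * Cw * μ.real Set.univ) := fun u u' => by
      rw [abs_mul, abs_mul]
      exact mul_le_mul (mul_le_mul (hnbd u) (hkb u u') (abs_nonneg _) (Real.sqrt_nonneg _)) (hnbd u') (abs_nonneg _)
        (mul_nonneg (Real.sqrt_nonneg _) ((abs_nonneg _).trans (hkb u u')))
    rw [integral_integral_eq_prod (μ := ν) mL bL, integral_integral_eq_prod (μ := ν) mnn bnn, ← integral_const_mul]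
    refine integral_mono (integrable_prod_of_bdd (μ := ν) mL bL) ((integrable_prod_of_bdd (μ := ν) mnn bnn).const_mul _) fun p => ?_
    have h := mul_le_mul_of_nonneg_left (hFabs p.1 p.2) (hk0 p.1 p.2)
    nlinarith [h]
  -- the slow operator bound, four times
  have en2 : ∫ u, n u ^ 2 ∂ν = ∫ u, ∫ x, v (u, x) ^ 2 * w x ∂μ ∂ν := integral_congr_ae (ae_of_all _ fun u => hn2 u)
  have ec2 : ∫ u, c u ^ 2 ∂ν = ∫ u, (∫ x, v (u, x) * Θ x * w x ∂μ) ^ 2 / Z ∂ν := integral_congr_ae (ae_of_all _ fun u => hc2 u)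
  have hN0 : 0 ≤ ∫ u, ∫ x, v (u, x) ^ 2 * w x ∂μ ∂ν := by rw [← en2]; exact integral_nonneg fun u => sq_nonneg _
  have hC0 : 0 ≤ ∫ u, (∫ x, v (u, x) * Θ x * w x ∂μ) ^ 2 / Z ∂ν := by rw [← ec2]; exact integral_nonneg fun u => sq_nonneg _
  have onn := hkop n n hnmeas hnmeas ⟨_, hnbd⟩ ⟨_, hnbd⟩ hn0 hn0
  have occ := hkop c c hcmeas hcmeas ⟨_, hcbd⟩ ⟨_, hcbd⟩ hc0 hc0
  have ocn := hkop c n hcmeas hnmeas ⟨_, hcbd⟩ ⟨_, hnbd⟩ hc0 hn0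
  have onc := hkop n c hnmeas hcmeas ⟨_, hnbd⟩ ⟨_, hcbd⟩ hn0 hc0
  rw [en2, ec2] at *
  set N := ∫ u, ∫ x, v (u, x) ^ 2 * w x ∂μ ∂ν with hNdef
  set C := ∫ u, (∫ x, v (u, x) * Θ x * w x ∂μ) ^ 2 / Z ∂ν with hCdef
  have hsN : Real.sqrt N * Real.sqrt N = N := Real.mul_self_sqrt hN0
  have hsC : Real.sqrt C * Real.sqrt C = C := Real.mul_self_sqrt hC0
  -- Step 5: the absolute tail
  have h5 : ∫ p, ∫ q, |v p| * |v q| ∂(ν.prod μ) ∂(ν.prod μ) = (∫ p, |v p| ∂(ν.prod μ)) ^ 2 := by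
    rw [integral_integral_eq_prod (μ := ν.prod μ) maa baa, sq]
    exact integral_prod_mul (μ := ν.prod μ) (ν := ν.prod μ) (fun p : U × X => |v p|) (fun q : U × X => |v q|)
  rw [h5] at hstep1
  -- assemble
  have hmain : ∫ u, ∫ u', k u u' * (∫ x, ∫ x', v (u, x) * M x x' * v (u', x') ∂μ ∂μ) ∂ν ∂ν ≤
      Λ * (κ₀ * ((1 - θ₁) * N + A₁ * C + 2 * A₂ * (Real.sqrt N * Real.sqrt C))) := by
    refine hK1.trans (mul_le_mul_of_nonneg_left ?_ hΛ)
    have t1 := mul_le_mul_of_nonneg_left onn hθ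
    have t2 := mul_le_mul_of_nonneg_left occ hA₁
    have t3 := mul_le_mul_of_nonneg_left (add_le_add ocn onc) hA₂
    rw [hsN] at t1; rw [hsC] at t2
    nlinarith [t1, t2, t3, mul_comm (Real.sqrt N) (Real.sqrt C)]
  have habs : ∫ u, ∫ u', k u u' * (∫ x, ∫ x', |v (u, x)| * M x x' * |v (u', x')| ∂μ ∂μ) ∂ν ∂ν ≤ Λ * ((1 - θ₁) + A₁ + 2 * A₂) * (κ₀ * N) := by
    refine hK2.trans (mul_le_mul_of_nonneg_left ?_ (mul_nonneg hΛ (by linarith)))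
    have := onn; rw [hsN] at this; exact this
  have hηabs := mul_le_mul_of_nonneg_left habs hηt
  nlinarith [hstep1, hmain, hηabs]

end Assembly

end Summit.QuantumFields.YangMills.Theorems.FemtoTransferGap.StiffDoor

end
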